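import Literature.Geometry.Riemannian.GurskyViaclovskyClosednessChartEllipticity
import Literature.Geometry.Riemannian.GurskyViaclovskyClosednessMargin
import HarnessLib

/-!
# Gursky–Viaclovsky closedness: admissibility with margin of the solution's jets and of the
# hybrid jets (the `δ₀`-assembly for Gilbarg–Trudinger's hypothesis (ii)')

Support file (everything PROVED; no definition, no named fact) for the named fact
`Literature.Geometry.Riemannian.gurskyViaclovsky_pathClosed_weighted_four`.

Write `𝒜 = 𝒜^t(y,p,r)` (`gvForm`), `τ = tr_G 𝒜` (`mtrAt`), `ν = |𝒜|²_G` (`normSqAt`) and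
`Σ = ½(τ² − ν)`; in a `g_y`-orthonormal frame `b`, `τ = σ₁(M)`, `ν = |M|²`, `Σ = σ₂(M)` for the
frame array `M_{ac} = 𝒜(b_a, b_c)` (`trace_gvForm_eq_sigma1_frame`,
`normSqAt_gvForm_eq_frameNormSq`, `sigma2Inv_eq_sigma2_frame`). This file proves:

* `le_sigma2Inv_of_equation` — at the jet of a solution of the background equation with
  `q ≥ q₀ > 0`, `|f| ≤ C`: `Σ ≥ c := q₀e^{−4C}/4` (`4Σ − ¼|W|² = q e^{4f}`, `|W|² ≥ 0`);
* `sqrt_le_trace_of_equation` — with admissibility `backgroundScalar > 0` moreover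
  `τ ≥ √(2c)` (`τ = ((3−2t)/6)·backgroundScalar > 0` and `τ² = 2Σ + ν ≥ 2Σ`);
* `hybrid_ge_half` — **the `δ₀`-assembly**: a quantity `Φ` on the jet space, `L`-Lipschitz on
  the jet set `B̄(y₀,ρ) × B̄(0,P₀) × B̄(0,R₀)` (`exists_lipschitz_sigma2_gvForm`,
  `exists_lipschitz_trace_gvForm`), with `Φ ≥ c` at the jet `(x, DF(x), D²F(x))` of a `C²`
  function with `‖DF‖ ≤ P₀`, `‖D²F‖ ≤ R₀` on the ball, is `≥ c/2` at the HYBRID jet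
  `(y, DF(y), D²F(x))` whenever `L(1 + R₀)‖y − x‖ ≤ c/2` — so `δ₀ = c/(2L(1+R₀))` works,
  uniformly along a sequence with uniform chart `C²` bounds (`chart_c2_bounds`);
* `gammaTwoPos_frame_of_pos` — a jet with `Σ > 0`, `τ > 0` and symmetric `r` has an admissible
  frame array `M ∈ Γ₂⁺` with `σ₂(M) = Σ` (so `sqrt_sigma2_le_tangent` and
  `gammaTwoPos_sigma2_superlevel_convex` apply between the solution's array at `y` and the
  hybrid array).

## References

* D. Gilbarg, N. S. Trudinger, *Elliptic Partial Differential Equations of Second Order* (2001),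
  §17.4, proof of Thm. 17.14 (hybrid jets `(y,u(y),Du(y),D²u(x))`, `x ∈ B_{2R}`, `y ∈ B_R`).
  [GilbargTrudinger2001]
* M. J. Gursky, J. A. Viaclovsky, J. Differential Geom. 63 (2003) 131–154, Prop. 6 and §5.
  [GurskyViaclovsky2003]
-/

noncomputable section

set_option maxSynthPendingDepth 3

open scoped Manifold ContDiff Topology
open Set Function Module Finset Metric

namespace Literature.Geometry.Riemannian.GurskyViaclovskyPath

open Literature.Geometry.Lorentzian (PseudoRiemannianMetric)
open Literature.Geometry.Lorentzian.PseudoRiemannianMetric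
open Literature.Geometry.Lorentzian
open Literature.Geometry.Riemannian.GurskyViaclovsky

/-! ### Frame formulas for `τ`, `ν`, `Σ` at an arbitrary jet -/

section OpensChart

variable {U : TopologicalSpace.Opens (EuclideanSpace ℝ (Fin 4))}
  (g : PseudoRiemannianMetric 𝓘(ℝ, EuclideanSpace ℝ (Fin 4)) ∞ (EuclideanSpace ℝ (Fin 4))
    (TangentSpace 𝓘(ℝ, EuclideanSpace ℝ (Fin 4)) : U → Type _))
  [g.HasLeviCivita]
  {G : EuclideanSpace ℝ (Fin 4) →
    EuclideanSpace ℝ (Fin 4) →L[ℝ] EuclideanSpace ℝ (Fin 4) →L[ℝ] ℝ}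
  (hG : ∀ y : U, g.val y = G y)

omit [g.HasLeviCivita] in
include hG in
/-- `τ = tr_G 𝒜 = σ₁(M)` in a `g_y`-orthonormal frame, for any jet. [folklore] -/
theorem trace_gvForm_eq_sigma1_frame (t : ℝ) (y : U)
    {b : Basis (Fin 4) ℝ (TangentSpace 𝓘(ℝ, EuclideanSpace ℝ (Fin 4)) y)}
    (hb : g.IsOrthonormalFrame y b) (p : EuclideanSpace ℝ (Fin 4) →L[ℝ] ℝ)
    (r : EuclideanSpace ℝ (Fin 4) →L[ℝ] EuclideanSpace ℝ (Fin 4) →L[ℝ] ℝ) :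
    MetricCoord.mtrAt G y (gvForm G t y p r) = sigma1 (fun a c ↦ gvForm G t y p r (b a) (b c)) := by
  rw [← OpensChart.trace_eq_mtrAt hG y (toBilin (gvForm G t y p r)) _ (fun v w' ↦ rfl),
    g.trace_eq_sum_of_isOrthonormalFrame b hb]
  rfl

omit [g.HasLeviCivita] in
include hG in
/-- `ν = |𝒜|²_G = |M|²` in a `g_y`-orthonormal frame, for any jet. [folklore] -/
theorem normSqAt_gvForm_eq_frameNormSq (t : ℝ) (y : U)
    {b : Basis (Fin 4) ℝ (TangentSpace 𝓘(ℝ, EuclideanSpace ℝ (Fin 4)) y)}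
    (hb : g.IsOrthonormalFrame y b) (p : EuclideanSpace ℝ (Fin 4) →L[ℝ] ℝ)
    (r : EuclideanSpace ℝ (Fin 4) →L[ℝ] EuclideanSpace ℝ (Fin 4) →L[ℝ] ℝ) :
    MetricCoord.normSqAt G y (gvForm G t y p r) =
      frameNormSq (fun a c ↦ gvForm G t y p r (b a) (b c)) := by
  classical
  have hO : (g.toBilinForm y).IsOrthoᵢ b := fun i j hij ↦ hb.2 i j hij
  have hcne : ∀ i, g.val y (b i) (b i) ≠ 0 := fun i ↦ by rw [hb.1 i]; exact one_ne_zero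
  rw [← OpensChart.normSq_eq_normSqAt hG y (toBilin (gvForm G t y p r)) _ (fun v w' ↦ rfl),
    g.normSq_eq_sum_sq y b hO hcne, frameNormSq, Finset.sum_comm]
  refine Finset.sum_congr rfl fun a _ ↦ Finset.sum_congr rfl fun c _ ↦ ?_
  rw [hb.1 a, hb.1 c, mul_one, div_one]
  rfl

omit [g.HasLeviCivita] in
include hG in
/-- `ν = |𝒜|²_G ≥ 0` (a sum of squares in an orthonormal frame; `g` Riemannian). [folklore] -/
theorem normSqAt_gvForm_nonneg (hg : g.IsRiemannian) (t : ℝ) (y : U)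
    (p : EuclideanSpace ℝ (Fin 4) →L[ℝ] ℝ)
    (r : EuclideanSpace ℝ (Fin 4) →L[ℝ] EuclideanSpace ℝ (Fin 4) →L[ℝ] ℝ) :
    0 ≤ MetricCoord.normSqAt G y (gvForm G t y p r) := by
  have hE : finrank ℝ (EuclideanSpace ℝ (Fin 4)) = 4 := finrank_euclideanSpace_fin
  obtain ⟨b, hb⟩ := g.exists_basis_isOrthonormalFrame (x := y) (fun v hv ↦ hg y v hv) hE
  rw [normSqAt_gvForm_eq_frameNormSq g hG t y hb p r, frameNormSq]
  exact Finset.sum_nonneg fun a _ ↦ Finset.sum_nonneg fun c _ ↦ sq_nonneg _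

include hG in
/-- **`Σ = σ₂(M)`** for a symmetric `r`: `½(τ² − ν) = σ₂` of the (symmetric) frame array.
[cite: GurskyViaclovsky2003, §5, proof of Lemma 3 (`σ₂ = ½(σ₁² − |A|²)`)] -/
theorem sigma2Inv_eq_sigma2_frame (t : ℝ) (y : U)
    {b : Basis (Fin 4) ℝ (TangentSpace 𝓘(ℝ, EuclideanSpace ℝ (Fin 4)) y)}
    (hb : g.IsOrthonormalFrame y b) (p : EuclideanSpace ℝ (Fin 4) →L[ℝ] ℝ)
    {r : EuclideanSpace ℝ (Fin 4) →L[ℝ] EuclideanSpace ℝ (Fin 4) →L[ℝ] ℝ}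
    (hr : ∀ v w, r v w = r w v) :
    1 / 2 * (MetricCoord.mtrAt G y (gvForm G t y p r) ^ 2 -
        MetricCoord.normSqAt G y (gvForm G t y p r)) =
      sigma2 (fun a c ↦ gvForm G t y p r (b a) (b c)) := by
  have h := chartOperator_eq_sigma2_frame g hG t 0 y hb p hr
  simp only [chartOperator, zero_div, sub_zero, mul_zero] at h
  linarith

include hG in
/-- The frame array of a jet with symmetric `r` is symmetric. [folklore] -/
theorem gvForm_frame_symm (t : ℝ) (y : U)
    (b : Basis (Fin 4) ℝ (TangentSpace 𝓘(ℝ, EuclideanSpace ℝ (Fin 4)) y))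
    (p : EuclideanSpace ℝ (Fin 4) →L[ℝ] ℝ)
    {r : EuclideanSpace ℝ (Fin 4) →L[ℝ] EuclideanSpace ℝ (Fin 4) →L[ℝ] ℝ}
    (hr : ∀ v w, r v w = r w v) (a c : Fin 4) :
    gvForm G t y p r (b a) (b c) = gvForm G t y p r (b c) (b a) := by
  have hn : (2 : ℕ∞ω) ≤ ((⊤ : ℕ∞) : ℕ∞ω) := WithTop.coe_le_coe.mpr le_top
  have hmet : MetricCoord.IsMetricOn G (U : Set (EuclideanSpace ℝ (Fin 4))) :=
    OpensChart.isMetricOn_repr hG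
  have hGs : ∀ v w, G y v w = G y w v := fun v w ↦ hmet.symm y y.2 v w
  have hRs : ∀ v w, MetricCoord.ricAt G y v w = MetricCoord.ricAt G y w v := fun v w ↦ by
    rw [← OpensChart.ricci_eq_ricAt hG y v w, ← OpensChart.ricci_eq_ricAt hG y w v]
    exact (g.ricci_symm_holds hn y).eq v w
  have hΓs : ∀ v w, MetricCoord.chrAt G y v w = MetricCoord.chrAt G y w v := fun v w ↦
    hmet.chrAt_comm y.2 v w
  rw [gvForm_apply, gvForm_apply, coordHess_apply, coordHess_apply, hGs (b a) (b c),
    hRs (b a) (b c), hΓs (b a) (b c), hr (b a) (b c), mul_comm (p (b a)) (p (b c))]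

include hG in
/-- **A jet with `Σ > 0`, `τ > 0` and symmetric `r` is admissible in every orthonormal frame**:
`M ∈ Γ₂⁺` and `σ₂(M) = Σ`. [cite: GurskyViaclovsky2003, §2 (the cone `Γ₂⁺`)] -/
theorem gammaTwoPos_frame_of_pos (t : ℝ) (y : U)
    {b : Basis (Fin 4) ℝ (TangentSpace 𝓘(ℝ, EuclideanSpace ℝ (Fin 4)) y)}
    (hb : g.IsOrthonormalFrame y b) (p : EuclideanSpace ℝ (Fin 4) →L[ℝ] ℝ)
    {r : EuclideanSpace ℝ (Fin 4) →L[ℝ] EuclideanSpace ℝ (Fin 4) →L[ℝ] ℝ}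
    (hr : ∀ v w, r v w = r w v)
    (hSig : 0 < 1 / 2 * (MetricCoord.mtrAt G y (gvForm G t y p r) ^ 2 -
        MetricCoord.normSqAt G y (gvForm G t y p r)))
    (hτ : 0 < MetricCoord.mtrAt G y (gvForm G t y p r)) :
    GammaTwoPos (fun a c ↦ gvForm G t y p r (b a) (b c)) ∧
      sigma2 (fun a c ↦ gvForm G t y p r (b a) (b c)) =
        1 / 2 * (MetricCoord.mtrAt G y (gvForm G t y p r) ^ 2 -
          MetricCoord.normSqAt G y (gvForm G t y p r)) := by
  have h2 := sigma2Inv_eq_sigma2_frame g hG t y hb p hr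
  have h1 := trace_gvForm_eq_sigma1_frame g hG t y hb p r
  refine ⟨⟨?_, ?_⟩, h2.symm⟩
  · rwa [h1] at hτ
  · rwa [h2] at hSig

/-! ### Margins at the solution's own jet -/

include hG in
/-- **`Σ ≥ q₀e^{−4C}/4` at the jet of a solution** of the background equation
`backgroundPathOperator g t (−f) y = q(y)e^{4f(y)}` with `q(y) ≥ q₀ > 0`, `|f(y)| ≤ C`:
`4Σ − ¼|W|² = q e^{4f}` (`backgroundPathOperator_eq_chartOperator`) and `|W|² ≥ 0`.
[cite: GurskyViaclovsky2003, Prop. 6 (proof: `σ₂ ≥ c > 0` along the path)] -/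
theorem le_sigma2Inv_of_equation (hg : g.IsRiemannian) (t : ℝ) {f : U → ℝ}
    (hf : ContMDiff 𝓘(ℝ, EuclideanSpace ℝ (Fin 4)) 𝓘(ℝ) ∞ f) {F : EuclideanSpace ℝ (Fin 4) → ℝ}
    (hfF : ∀ y : U, f y = F y) {q : U → ℝ} {q₀ C : ℝ} (hq₀ : 0 < q₀) (y : U)
    (hF : ContDiffAt ℝ 2 F y) (hqy : q₀ ≤ q y)
    (heq : backgroundPathOperator g t (fun z ↦ -f z) y = q y * Real.exp (-4 * (-f y)))
    (hfy : |f y| ≤ C) :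
    q₀ * Real.exp (-4 * C) / 4 ≤
      1 / 2 * (MetricCoord.mtrAt G y (gvForm G t y (fderiv ℝ F y) (fderiv ℝ (fderiv ℝ F) y)) ^ 2 -
        MetricCoord.normSqAt G y (gvForm G t y (fderiv ℝ F y) (fderiv ℝ (fderiv ℝ F) y))) := by
  have hch := backgroundPathOperator_eq_chartOperator g hG hg t hf hfF y hF
  rw [heq, chartOperator] at hch
  have hW : 0 ≤ g.weylNormSq y := g.weylNormSq_nonneg y
  have hexp : Real.exp (-4 * C) ≤ Real.exp (-4 * (-f y)) :=
    Real.exp_le_exp.2 (by linarith [(abs_le.1 hfy).1])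
  have h1 : q₀ * Real.exp (-4 * C) ≤ q y * Real.exp (-4 * (-f y)) :=
    mul_le_mul hqy hexp (Real.exp_pos _).le (hq₀.le.trans hqy)
  linarith

include hG in
/-- **`τ ≥ √(2c)` at the jet of an admissible solution**: `τ = ((3−2t)/6)·backgroundScalar > 0`
(`sigma1_gvMatrix`, `backgroundScalar_eq_frame`, `t ≤ 1`) and `τ² = 2Σ + ν ≥ 2Σ ≥ 2c`.
[cite: GurskyViaclovsky2003, Prop. 6 (proof), §3 proof of Prop. 3] -/
theorem sqrt_le_trace_of_equation (hg : g.IsRiemannian) {t : ℝ} (ht : t ≤ 1) {f : U → ℝ}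
    (hf : ContMDiff 𝓘(ℝ, EuclideanSpace ℝ (Fin 4)) 𝓘(ℝ) ∞ f) {F : EuclideanSpace ℝ (Fin 4) → ℝ}
    (hfF : ∀ y : U, f y = F y) {q : U → ℝ} {q₀ C : ℝ} (hq₀ : 0 < q₀) (y : U)
    (hF : ContDiffAt ℝ 2 F y) (hqy : q₀ ≤ q y)
    (heq : backgroundPathOperator g t (fun z ↦ -f z) y = q y * Real.exp (-4 * (-f y)))
    (hpos : 0 < backgroundScalar g (fun z ↦ -f z) y) (hfy : |f y| ≤ C) :
    Real.sqrt (2 * (q₀ * Real.exp (-4 * C) / 4)) ≤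
      MetricCoord.mtrAt G y (gvForm G t y (fderiv ℝ F y) (fderiv ℝ (fderiv ℝ F) y)) := by
  have hE : finrank ℝ (EuclideanSpace ℝ (Fin 4)) = 4 := finrank_euclideanSpace_fin
  have hn : (2 : ℕ∞ω) ≤ ((⊤ : ℕ∞) : ℕ∞ω) := WithTop.coe_le_coe.mpr le_top
  obtain ⟨b, hb⟩ := g.exists_basis_isOrthonormalFrame (x := y) (fun v hv ↦ hg y v hv) hE
  set τ := MetricCoord.mtrAt G y (gvForm G t y (fderiv ℝ F y) (fderiv ℝ (fderiv ℝ F) y)) with hτ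
  -- `τ > 0`
  have hRc : ∀ a c, (fun a c ↦ g.ricci y (b a) (b c)) a c = (fun a c ↦ g.ricci y (b a) (b c)) c a :=
    fun a c ↦ (g.ricci_symm_holds hn y).eq (b a) (b c)
  have hRsum : ∑ a, (fun a c ↦ g.ricci y (b a) (b c)) a a = g.scalarCurvature y :=
    hb.sum_ricci_eq_scalarCurvature g hE
  have hτpos : 0 < τ := by
    have h1 := trace_gvForm_eq_sigma1_frame g hG t y hb (fderiv ℝ F y) (fderiv ℝ (fderiv ℝ F) y)
    have harr : (fun a c ↦ gvForm G t y (fderiv ℝ F y) (fderiv ℝ (fderiv ℝ F) y) (b a) (b c)) =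
        gvMatrix t (g.scalarCurvature y) (fun a c ↦ g.ricci y (b a) (b c))
          (fun a c ↦ g.hessian (fun z ↦ -f z) y (b a) (b c))
          (fun a ↦ mvfderiv 𝓘(ℝ, EuclideanSpace ℝ (Fin 4)) (fun z ↦ -f z) y (b a)) := by
      funext a c
      exact gvForm_frame_eq_gvMatrix g hG t hfF y hF hb a c
    rw [hτ, h1, harr, sigma1_gvMatrix t hRsum, ← backgroundScalar_eq_frame g (fun z ↦ -f z) hb]
    exact mul_pos (by linarith) hpos
  -- `τ² ≥ 2Σ ≥ 2c`
  have hSig := le_sigma2Inv_of_equation g hG hg t hf hfF hq₀ y hF hqy heq hfy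
  have hν := normSqAt_gvForm_nonneg g hG hg t y (fderiv ℝ F y) (fderiv ℝ (fderiv ℝ F) y)
  have hsq : 2 * (q₀ * Real.exp (-4 * C) / 4) ≤ τ ^ 2 := by rw [hτ]; linarith
  calc Real.sqrt (2 * (q₀ * Real.exp (-4 * C) / 4)) ≤ Real.sqrt (τ ^ 2) := Real.sqrt_le_sqrt hsq
    _ = τ := Real.sqrt_sq hτpos.le

end OpensChart

/-! ### The `δ₀`-assembly: hybrid jets keep half the margin -/

section Hybrid

variable {E : Type*} [NormedAddCommGroup E] [NormedSpace ℝ E]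

/-- **Hybrid jets keep half the margin.** Let `Φ` be `L`-Lipschitz on the jet set
`𝒥 = B̄(y₀,ρ) × B̄(0,P₀) × B̄(0,R₀)`, let `F` have `‖DF‖ ≤ P₀`, `‖D²F‖ ≤ R₀` on `B̄(y₀,ρ)` with
`DF` differentiable there, and let `Φ ≥ c` at the jet `(x, DF x, D²F x)`. Then `Φ ≥ c/2` at the
hybrid jet `(y, DF y, D²F x)` whenever `L(1 + R₀)‖y − x‖ ≤ c/2`: the two jets are at distance
`≤ max(‖y−x‖, ‖DF y − DF x‖) ≤ (1 + R₀)‖y − x‖` by the mean value inequality.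
[cite: GilbargTrudinger2001, §17.4, proof of Thm. 17.14 (hybrid jets)] -/
theorem hybrid_ge_half {Φ : (E × (E →L[ℝ] ℝ) × (E →L[ℝ] E →L[ℝ] ℝ)) → ℝ} {y₀ : E}
    {ρ P₀ R₀ L c : ℝ} (hL : 0 ≤ L)
    (hLip : ∀ j ∈ closedBall y₀ ρ ×ˢ (closedBall (0 : E →L[ℝ] ℝ) P₀ ×ˢ
        closedBall (0 : E →L[ℝ] E →L[ℝ] ℝ) R₀),
      ∀ j' ∈ closedBall y₀ ρ ×ˢ (closedBall (0 : E →L[ℝ] ℝ) P₀ ×ˢ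
        closedBall (0 : E →L[ℝ] E →L[ℝ] ℝ) R₀), |Φ j' - Φ j| ≤ L * ‖j' - j‖)
    {F : E → ℝ} (hFd : ∀ z ∈ closedBall y₀ ρ, DifferentiableAt ℝ (fderiv ℝ F) z)
    (hP : ∀ z ∈ closedBall y₀ ρ, ‖fderiv ℝ F z‖ ≤ P₀)
    (hR : ∀ z ∈ closedBall y₀ ρ, ‖fderiv ℝ (fderiv ℝ F) z‖ ≤ R₀)
    {x y : E} (hx : x ∈ closedBall y₀ ρ) (hy : y ∈ closedBall y₀ ρ)
    (hc : c ≤ Φ (x, fderiv ℝ F x, fderiv ℝ (fderiv ℝ F) x))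
    (hδ : L * ((1 + R₀) * ‖y - x‖) ≤ c / 2) :
    c / 2 ≤ Φ (y, fderiv ℝ F y, fderiv ℝ (fderiv ℝ F) x) := by
  have hR0 : 0 ≤ R₀ := (norm_nonneg (fderiv ℝ (fderiv ℝ F) x)).trans (hR x hx)
  have hjx : (x, fderiv ℝ F x, fderiv ℝ (fderiv ℝ F) x) ∈ closedBall y₀ ρ ×ˢ
      (closedBall (0 : E →L[ℝ] ℝ) P₀ ×ˢ closedBall (0 : E →L[ℝ] E →L[ℝ] ℝ) R₀) :=
    ⟨hx, mem_closedBall_zero_iff.2 (hP x hx), mem_closedBall_zero_iff.2 (hR x hx)⟩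
  have hjy : (y, fderiv ℝ F y, fderiv ℝ (fderiv ℝ F) x) ∈ closedBall y₀ ρ ×ˢ
      (closedBall (0 : E →L[ℝ] ℝ) P₀ ×ˢ closedBall (0 : E →L[ℝ] E →L[ℝ] ℝ) R₀) :=
    ⟨hy, mem_closedBall_zero_iff.2 (hP y hy), mem_closedBall_zero_iff.2 (hR x hx)⟩
  -- mean value for `DF` on the convex ball
  have hmv : ‖fderiv ℝ F y - fderiv ℝ F x‖ ≤ R₀ * ‖y - x‖ :=
    (convex_closedBall y₀ ρ).norm_image_sub_le_of_norm_fderiv_le hFd hR hx hy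
  -- distance of the two jets
  have hdist : ‖(y, fderiv ℝ F y, fderiv ℝ (fderiv ℝ F) x) -
      (x, fderiv ℝ F x, fderiv ℝ (fderiv ℝ F) x)‖ ≤ (1 + R₀) * ‖y - x‖ := by
    rw [Prod.mk_sub_mk, Prod.mk_sub_mk, sub_self, Prod.norm_def, Prod.norm_def, norm_zero]
    refine max_le ?_ (max_le ?_ ?_)
    · nlinarith [norm_nonneg (y - x)]
    · nlinarith [norm_nonneg (y - x)]
    · positivity
  have h := hLip _ hjx _ hjy
  refine half_le_of_lipschitz h hc ?_
  calc L * ‖(y, fderiv ℝ F y, fderiv ℝ (fderiv ℝ F) x) - (x, fderiv ℝ F x, fderiv ℝ (fderiv ℝ F) x)‖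
      ≤ L * ((1 + R₀) * ‖y - x‖) := mul_le_mul_of_nonneg_left hdist hL
    _ ≤ c / 2 := hδ

end Hybrid

end Literature.Geometry.Riemannian.GurskyViaclovskyPath

end
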